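import Summits.BirchSwinnertonDyer.BirchSwinnertonDyer.Theorems.ByReductionTypeAtTwoAdditivePotMultKatoHalf
import Literature.NumberTheory.EllipticCurves.Kato2004.AdditiveNoSplitTwistNegOneRankZeroShaUpperBoundPlusOneAtTwo
import Literature.NumberTheory.EllipticCurves.BSDShaProofs
import HarnessLib

/-!
# Crux `AdditiveRankZeroAtTwo` (K4 item 19098), child C4″ `AdditivePotMultOverKAtTwo` (item 22618): the twist-by-`−2` classes —
# the Kato half UP TO `+ 1` under «`W^{(−1)}` not split multiplicative at `2`», and the `+ 1` removed by Cassels–Tate squareness when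
# `ord₂ #Ш_an` is even (seat `bsd-2adic-addL2x` GEN 13; `--supports`; sequel of `…AdditivePotMultKatoHalf.lean`, outside the route cone)

HONEST FRAMING (cell `bsd-2adic`, D-0036/D-0054): types-the-object-of; closes none at the ∀-level; nothing booked; BSD is not proved
by any of this. Conditional helpers; no item is closed by this file.

WHAT THIS FILE DOES. The third GEN 13 reading
`Kato2004.rankZero_padicValNat_sha_add_padicValNat_tamagawa_le_add_one_at_two_of_noSplitTwistNegOne_of_irreducible_of_fineSelmerDual_fg`
(file `Kato2004/AdditiveNoSplitTwistNegOneRankZeroShaUpperBoundPlusOneAtTwo.lean`): for an ADDITIVE curve at `2` whose twist by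
`−1` is NOT split multiplicative (hypothesis (NST″); the twist by `−2` MAY be split — then Kato's local term is met by step T3 with
length `1` at a prime `(X − a)`, `v₂(a) = 1`, T17) the rank-`0` bound holds with `+ 1`. Exactly as GEN 5's `…_of_even` doors
(`ByReductionTypeAtTwoAdditiveKatoFineDescentAtTwo.lean`), the `+ 1` is removed by the squareness of `#Ш` (Cassels–Tate,
`isSquare_shaOrder_of_casselsTate`) as soon as `ord₂ #Ш_an` is EVEN — the parity side condition that child C2″ already carries and
that the crux itself implies (GEN 12's `…ShaAnParity`). Census: the 39 potentially multiplicative classes with `d* = −2` split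
(30 with irreducible `E[2]`) join; with `…AdditivePotMultKatoHalf.lean` the Kato half now reaches 294 of the 463 potentially
multiplicative classes (224 irreducible); C4″ stays needed on the 169 classes with `E^{(−1)}` split multiplicative (+ reducible `E[2]`).

* §0 `padicValNat_le_two_mul_of_isSquare_of_le_succ'` — arithmetic of squares (private twin of GEN 5's lemma, to stay route-free);
  `katoFineSelmerAtTwo'_of_katoAtTwoPlusOne` — the reading implies GEN 5's `Δ`-free `+ 1` reading (pot-good ⟹ (NST″)).
* §1 `padicValNat_shaOrder_le_add_one_of_katoAtTwoPlusOne_rankZero` — Miller currency: `#Ш_an = q`, `ord₂ #Ш ≤ ord₂ q + 1 − 2·ord₂ #tors`.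
* §2 `missingUpperBoundAt_two_of_katoAtTwoPlusOne_of_even` — the KATO HALF at a curve: non-CM, `r_an = 0`, additive at `2`,
  `W^{(−1)}` not split multiplicative at `2`, `E[2]` irreducible, (A) at `(W,2)`, and `ord₂ #Ш_an` even ⟹ `MissingUpperBoundAt W 2`;
  `…_of_isAbelianGalois` variant with (A) from print.
* §3 `addPotMultNST2_upper_two_of_conjA_of_even` — BLOCK form on {pot-mult, `W^{(−1)}` not split, irreducible, `ord₂ #Ш_an` even},
  inputs (A) on the non-abelian part (`hAnaM2`) — no over-`K` object.

Binders: `hPlus` = the `+ 1` reading (flag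
`Kato-12.5(3)-(12.5.1)-13.13-T3-T6-at-two-additive-noSplitTwistNegOne-irreducible-fineSelmer-fg-plus-one`, D-audit owed); `hGZK`,
`hmod`, `hCT` (squareness of `#Ш`), `hLim2`/`hFW` (abelian case). Memo `run/shared/lean/pub/bsd-2adic/addL2x/VERDICT-19098-addL2x-GEN13.md`.

References: [Kato2004Asterisque] Thm. 12.5 (3), (12.5.1), 13.13, 14.14–14.15; [SilvermanATAEC1994] V.5.3; [SilvermanAEC2009]
X.4.14 (Cassels–Tate: `#Ш` square); [CoatesSujatha2005] statement (A); [Miller2011LMS] Def. 1.1.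
-/

set_option autoImplicit false
set_option linter.dupNamespace false

noncomputable section

open scoped Classical

namespace Summit.BirchSwinnertonDyer.BirchSwinnertonDyer.Theorems.AddKatoTwo

open WeierstrassCurve Literature.NumberTheory.EllipticCurves
  Literature.NumberTheory.EllipticCurves.Rank1Residual
  Literature.NumberTheory.EllipticCurves.Rank1Residual.Typed
  Literature.NumberTheory.IwasawaTheory
  Summit.BirchSwinnertonDyer.Rank1Residual.AdditivePotMult
  Summit.BirchSwinnertonDyer.Rank1Residual.X5.AddTwoL2

/-! ## §0 Squares; the reading implies GEN 5's `+ 1` reading -/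

/-- A non-zero perfect square with `p`-adic valuation `≤ 2k + 1` has valuation `≤ 2k`. Route-free twin of GEN 5's
`padicValNat_le_two_mul_of_isSquare_of_le_succ` (that file imports the route). [folklore] -/
theorem padicValNat_le_two_mul_of_isSquare_of_le_succ' {p n : ℕ} {k : ℤ} [Fact p.Prime] (hsq : IsSquare n) (hn : n ≠ 0)
    (hle : (padicValNat p n : ℤ) ≤ 2 * k + 1) : (padicValNat p n : ℤ) ≤ 2 * k := by
  obtain ⟨r, rfl⟩ := hsq
  have hr : r ≠ 0 := fun h => hn (by simp [h])
  rw [padicValNat.mul hr hr] at hle ⊢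
  push_cast at hle ⊢
  omega

/-- **The `+ 1` reading under (NST″) IMPLIES GEN 5's `Δ`-free `+ 1` potentially-good reading**: a potentially good curve has no
split multiplicative twist by `−1` (`not_hasSplitMultiplicativeReduction_quadraticTwist_of_padicValRat_j_nonneg`). Bookkeeping.
[cite: Kato2004Asterisque, Thm. 12.5 (3) and (12.5.1) (p. 222)] -/
theorem katoFineSelmerAtTwo'_of_katoAtTwoPlusOne
    (h : Kato2004.rankZero_padicValNat_sha_add_padicValNat_tamagawa_le_add_one_at_two_of_noSplitTwistNegOne_of_irreducible_of_fineSelmerDual_fg) :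
    Kato2004.rankZero_padicValNat_sha_add_padicValNat_tamagawa_le_add_one_at_two_of_irreducible_of_fineSelmerDual_fg := by
  intro W _ _ hcm hgood hmult hpot hirr hA hL hfin
  exact h W hcm hgood hmult
    (not_hasSplitMultiplicativeReduction_quadraticTwist_of_padicValRat_j_nonneg W hpot (by norm_num)) hirr hA hL hfin

/-! ## §1 Miller currency, `+ 1` -/

/-- **Rank-`0` upper bound UP TO ONE FACTOR OF `2` under (NST″)**: for a non-CM globally minimal `W`, additive at `2`, with
`W^{(−1)}` not split multiplicative at `2`, `E[2]` irreducible, `r_an = 0` and (A) at `(E,2)`: `#Ш_an = q` and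
`ord₂ #Ш ≤ ord₂ q + 1 − 2·ord₂ #E(ℚ)_tors`. Proof word for word as GEN 5's `padicValNat_shaOrder_le_add_one_of_katoFineSelmerAtTwo_rankZero`.
[cite: Kato2004Asterisque, Thm. 12.5 (1)(3) (pp. 221–222), 13.13 (p. 233), 14.14 and Lemma 14.15 (pp. 243–244)]
[cite: CoatesSujatha2005, statement (A)] [cite: Miller2011LMS, Def. 1.1] -/
theorem padicValNat_shaOrder_le_add_one_of_katoAtTwoPlusOne_rankZero
    (hPlus : Kato2004.rankZero_padicValNat_sha_add_padicValNat_tamagawa_le_add_one_at_two_of_noSplitTwistNegOne_of_irreducible_of_fineSelmerDual_fg)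
    (hGZK : rank_eq_analyticRank_of_analyticRank_le_one) (hmod : hasEntireLFunction_rat)
    (W : WeierstrassCurve ℚ) [W.IsElliptic] [W.IsGloballyMinimal] (hcm : ¬ W.HasCM)
    (hgood : ¬ W.HasGoodReductionAtPrime 2) (hmult : ¬ W.HasMultiplicativeReductionAtPrime 2)
    (hm1 : ¬ (W.quadraticTwist (-1)).HasSplitMultiplicativeReductionAtPrime 2)
    (hirr : W.HasIrreducibleModPGaloisRep 2)
    (hA : ∀ (κ : ZpExtension ℚ 2), κ.IsCyclotomic →
      ∃ (γ : Field.absoluteGaloisGroup ℚ) (D : W.FineSelmerDualData κ γ),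
        Module.Finite ℤ_[2] (RestrictScalars ℤ_[2] (IwasawaAlgebra 2) D.X))
    (hr : W.analyticRank = 0) :
    ∃ q : ℚ, shaAn W = (q : ℂ) ∧
      (padicValNat 2 W.shaOrder : ℤ) ≤ padicValRat 2 q + 1 - 2 * padicValNat 2 W.torsionOrder := by
  have hL : W.entireLFunction 1 ≠ 0 := (W.analyticRank_eq_zero_iff_holds (hmod W)).mp hr
  obtain ⟨hmw, hfin⟩ := hGZK W (by rw [hr]; exact zero_le_one)
  haveI : Finite W.sha := hfin
  have hmw0 : W.mordellWeilRank = 0 := by rw [hmw, hr]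
  obtain ⟨q₀, hq₀, hle⟩ := hPlus W hcm hgood hmult hm1 hirr hA hL hfin
  have hΩpos : 0 < W.realPeriodRat := W.realPeriodRat_pos_holds
  have hΩ : (W.realPeriodRat : ℂ) ≠ 0 := by exact_mod_cast hΩpos.ne'
  have hc0 : 0 < W.tamagawaProduct := W.tamagawaProduct_pos_holds
  have ht0 : 0 < W.torsionOrder := W.torsionOrder_pos_holds
  have hq₀0 : q₀ ≠ 0 := by
    rintro rfl
    rw [Rat.cast_zero, div_eq_zero_iff] at hq₀
    exact hq₀.elim hL hΩ
  refine ⟨q₀ * (W.torsionOrder : ℚ) ^ 2 / (W.tamagawaProduct : ℚ), ?_, ?_⟩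
  · have hLq : W.entireLFunction 1 = (q₀ : ℂ) * (W.realPeriodRat : ℂ) := by
      rw [← hq₀, div_mul_cancel₀ _ hΩ]
    rw [shaAn_def, leadingLCoeff_eq_of_analyticRank_eq_zero W hr,
      W.regulator_eq_one_of_rank_zero hmw0, hLq]
    push_cast
    field_simp
  · have ht : (W.torsionOrder : ℚ) ≠ 0 := by exact_mod_cast ht0.ne'
    have hcq : (W.tamagawaProduct : ℚ) ≠ 0 := by exact_mod_cast hc0.ne'
    have hsha : padicValNat 2 (Nat.card (AddCommGroup.primaryComponent W.sha 2)) =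
        padicValNat 2 W.shaOrder := by
      unfold WeierstrassCurve.shaOrder
      exact padicValNat_card_addPrimaryComponent 2
    have hv : padicValRat 2 (q₀ * (W.torsionOrder : ℚ) ^ 2 / (W.tamagawaProduct : ℚ)) =
        padicValRat 2 q₀ + 2 * (padicValNat 2 W.torsionOrder : ℤ) -
          (padicValNat 2 W.tamagawaProduct : ℤ) := by
      rw [padicValRat.div (mul_ne_zero hq₀0 (pow_ne_zero 2 ht)) hcq,
        padicValRat.mul hq₀0 (pow_ne_zero 2 ht), pow_two, padicValRat.mul ht ht,
        padicValRat.of_nat, padicValRat.of_nat]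
      ring
    rw [hv, ← hsha]
    linarith

/-! ## §2 The KATO HALF at a curve under (NST″) with even `ord₂ #Ш_an` -/

/-- **The Kato half at a curve from statement (A) at `(E,2)` and the parity of `ord₂ #Ш_an`, for ADDITIVE reduction at `2` with
`W^{(−1)}` NOT split multiplicative** (the twist by `−2` may be split multiplicative — the 39 `d* = −2`-split census classes).
Granted the `+ 1` reading `hPlus`, GZK, modularity and the Cassels–Tate pairing (`#Ш` is a square): if (A) holds at `(W,2)` and
`ord₂ #Ш_an` is even (`hpar`, the parity side condition of child C2″; implied by BSD₂), then `MissingUpperBoundAt W 2`.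
[cite: Kato2004Asterisque, Thm. 12.5 (3) and (12.5.1) (p. 222), 13.13 (p. 233), 14.14–14.15 (pp. 243–244)]
[cite: SilvermanAEC2009, Thm. X.4.14] [cite: CoatesSujatha2005, statement (A)] [cite: Miller2011LMS, Def. 1.1] -/
theorem missingUpperBoundAt_two_of_katoAtTwoPlusOne_of_even
    (hPlus : Kato2004.rankZero_padicValNat_sha_add_padicValNat_tamagawa_le_add_one_at_two_of_noSplitTwistNegOne_of_irreducible_of_fineSelmerDual_fg)
    (hGZK : rank_eq_analyticRank_of_analyticRank_le_one) (hmod : hasEntireLFunction_rat)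
    (hCT : exists_casselsTate_pairing (K := ℚ))
    (W : WeierstrassCurve ℚ) [W.IsElliptic] [W.IsGloballyMinimal] (hcm : ¬ W.HasCM) (hr : W.analyticRank = 0)
    (hadd : Addv W 2) (hm1 : ¬ (W.quadraticTwist (-1)).HasSplitMultiplicativeReductionAtPrime 2)
    (hirr : W.HasIrreducibleModPGaloisRep 2)
    (hA : ∀ (κ : ZpExtension ℚ 2), κ.IsCyclotomic →
      ∃ (γ : Field.absoluteGaloisGroup ℚ) (D : W.FineSelmerDualData κ γ),
        Module.Finite ℤ_[2] (RestrictScalars ℤ_[2] (IwasawaAlgebra 2) D.X))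
    (hpar : ∀ q : ℚ, shaAn W = (q : ℂ) → Even (padicValRat 2 q)) :
    MissingUpperBoundAt W 2 := by
  haveI : Fact (Nat.Prime 2) := ⟨Nat.prime_two⟩
  obtain ⟨q, hq, hle⟩ :=
    padicValNat_shaOrder_le_add_one_of_katoAtTwoPlusOne_rankZero hPlus hGZK hmod W hcm hadd.1 hadd.2 hm1 hirr hA hr
  rw [padicValNat_torsionOrder_eq_zero_of_irreducible W 2 hirr] at hle
  simp only [Nat.cast_zero, mul_zero, sub_zero] at hle
  obtain ⟨k, hk⟩ := hpar q hq
  have hfin : W.ShaFinite := (hGZK W (by rw [hr]; exact zero_le_one)).2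
  have hsq : IsSquare W.shaOrder := isSquare_shaOrder_of_casselsTate hCT W hfin
  have hn : W.shaOrder ≠ 0 := (WeierstrassCurve.shaOrder_pos W hfin).ne'
  have hk2 : padicValRat 2 q = 2 * k := by rw [hk]; ring
  rw [hk2] at hle
  exact ⟨q, hq, by rw [hk2]; exact padicValNat_le_two_mul_of_isSquare_of_le_succ' hsq hn hle⟩

/-- The same with statement (A) DISCHARGED from print when `ℚ(E[2])` is abelian (Lim@2 + Ferrero–Washington,
`conjA_two_of_isAbelianGalois_divisionField_two`). [cite: Lim2017FineSelmer, §3 Thm. 3.5] [cite: FerreroWashington1979, Theorem]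
[cite: Kato2004Asterisque, Thm. 12.5 (3) (p. 222)] -/
theorem missingUpperBoundAt_two_of_katoAtTwoPlusOne_of_even_of_isAbelianGalois
    (hPlus : Kato2004.rankZero_padicValNat_sha_add_padicValNat_tamagawa_le_add_one_at_two_of_noSplitTwistNegOne_of_irreducible_of_fineSelmerDual_fg)
    (hGZK : rank_eq_analyticRank_of_analyticRank_le_one) (hmod : hasEntireLFunction_rat)
    (hCT : exists_casselsTate_pairing (K := ℚ))
    (hLim2 : Lim2017.thm35_at_two_fineSelmerDual_moduleFinite_of_classicalMuVanishes_of_le_divisionField_four)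
    (hFW : ferreroWashington1979_classicalMuVanishes)
    (W : WeierstrassCurve ℚ) [W.IsElliptic] [W.IsGloballyMinimal] (hcm : ¬ W.HasCM) (hr : W.analyticRank = 0)
    (hadd : Addv W 2) (hm1 : ¬ (W.quadraticTwist (-1)).HasSplitMultiplicativeReductionAtPrime 2)
    (hirr : W.HasIrreducibleModPGaloisRep 2) (hab : IsAbelianGalois ℚ (W.divisionField 2))
    (hpar : ∀ q : ℚ, shaAn W = (q : ℂ) → Even (padicValRat 2 q)) :
    MissingUpperBoundAt W 2 := by
  haveI := hab
  exact missingUpperBoundAt_two_of_katoAtTwoPlusOne_of_even hPlus hGZK hmod hCT W hcm hr hadd hm1 hirr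
    (conjA_two_of_isAbelianGalois_divisionField_two hLim2 hFW W) hpar

/-- **BSD₂ at a curve under (NST″) from (A), the parity of `ord₂ #Ш_an`, and the LOWER half over `ℚ`.**
[cite: Kato2004Asterisque, Thm. 12.5 (3) (p. 222), 13.13 (p. 233)] [cite: Miller2011LMS, §1 and Def. 1.1] -/
theorem bsdp_two_of_katoAtTwoPlusOne_of_even_of_lower
    (hPlus : Kato2004.rankZero_padicValNat_sha_add_padicValNat_tamagawa_le_add_one_at_two_of_noSplitTwistNegOne_of_irreducible_of_fineSelmerDual_fg)
    (hGZK : rank_eq_analyticRank_of_analyticRank_le_one) (hmod : hasEntireLFunction_rat)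
    (hCT : exists_casselsTate_pairing (K := ℚ))
    (W : WeierstrassCurve ℚ) [W.IsElliptic] [W.IsGloballyMinimal] (hcm : ¬ W.HasCM) (hr : W.analyticRank = 0)
    (hadd : Addv W 2) (hm1 : ¬ (W.quadraticTwist (-1)).HasSplitMultiplicativeReductionAtPrime 2)
    (hirr : W.HasIrreducibleModPGaloisRep 2)
    (hA : ∀ (κ : ZpExtension ℚ 2), κ.IsCyclotomic →
      ∃ (γ : Field.absoluteGaloisGroup ℚ) (D : W.FineSelmerDualData κ γ),
        Module.Finite ℤ_[2] (RestrictScalars ℤ_[2] (IwasawaAlgebra 2) D.X))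
    (hpar : ∀ q : ℚ, shaAn W = (q : ℂ) → Even (padicValRat 2 q))
    (hlow : MissingLowerBoundAt W 2) : BSDp W 2 := by
  have hr1 : W.analyticRank ≤ 1 := by rw [hr]; exact zero_le_one
  exact bsdp_of_missingPPartAt W 2 hGZK hr1
    (missingPPartAt_of_lower_of_upper W 2 hlow
      (missingUpperBoundAt_two_of_katoAtTwoPlusOne_of_even hPlus hGZK hmod hCT W hcm hr hadd hm1 hirr hA hpar))

/-! ## §3 BLOCK form on {pot-mult, `W^{(−1)}` not split, irreducible, `ord₂ #Ш_an` even} -/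

/-- **The Kato half on the potentially multiplicative classes with `W^{(−1)}` not split multiplicative at `2`, `E[2]` irreducible
and `ord₂ #Ш_an` even** — in particular the `d* = −2`-split classes —, keyed like the children of the split: hypotheses
`¬CM → r_an = 0 → Addv W 2 → ord₂ j < 0 → ¬ split W^{(−1)} → irreducible → parity`, inputs (A) on the non-abelian-`ℚ(E[2])`
part (`hAnaM2`), PRINT {GZK, modularity, Cassels–Tate, Lim@2, FW} and the `+ 1` reading. No over-`K` object. Conditional; closes
nothing. [cite: Kato2004Asterisque, Thm. 12.5 (3) (p. 222), 13.13 (p. 233), 14.14 (p. 243)] [cite: CoatesSujatha2005, statement (A)]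
[cite: SilvermanAEC2009, Thm. X.4.14] -/
theorem addPotMultNST2_upper_two_of_conjA_of_even
    (hPlus : Kato2004.rankZero_padicValNat_sha_add_padicValNat_tamagawa_le_add_one_at_two_of_noSplitTwistNegOne_of_irreducible_of_fineSelmerDual_fg)
    (hGZK : rank_eq_analyticRank_of_analyticRank_le_one) (hmod : hasEntireLFunction_rat)
    (hCT : exists_casselsTate_pairing (K := ℚ))
    (hLim2 : Lim2017.thm35_at_two_fineSelmerDual_moduleFinite_of_classicalMuVanishes_of_le_divisionField_four)
    (hFW : ferreroWashington1979_classicalMuVanishes)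
    (hAnaM2 : ∀ (W : WeierstrassCurve ℚ) [W.IsElliptic] [W.IsGloballyMinimal], ¬ W.HasCM → W.analyticRank = 0 →
      Addv W 2 → padicValRat 2 W.j < 0 → ¬ (W.quadraticTwist (-1)).HasSplitMultiplicativeReductionAtPrime 2 →
      W.HasIrreducibleModPGaloisRep 2 → ¬ IsAbelianGalois ℚ (W.divisionField 2) →
      ∀ (κ : ZpExtension ℚ 2), κ.IsCyclotomic →
        ∃ (γ : Field.absoluteGaloisGroup ℚ) (D : W.FineSelmerDualData κ γ),
          Module.Finite ℤ_[2] (RestrictScalars ℤ_[2] (IwasawaAlgebra 2) D.X)) :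
    ∀ (W : WeierstrassCurve ℚ) [W.IsElliptic] [W.IsGloballyMinimal], ¬ W.HasCM → W.analyticRank = 0 →
      Addv W 2 → padicValRat 2 W.j < 0 → ¬ (W.quadraticTwist (-1)).HasSplitMultiplicativeReductionAtPrime 2 →
      W.HasIrreducibleModPGaloisRep 2 → (∀ q : ℚ, shaAn W = (q : ℂ) → Even (padicValRat 2 q)) →
      MissingUpperBoundAt W 2 := by
  intro W _ _ hcm hr hadd hj hm1 hirr hpar
  by_cases hab : IsAbelianGalois ℚ (W.divisionField 2)
  · exact missingUpperBoundAt_two_of_katoAtTwoPlusOne_of_even_of_isAbelianGalois hPlus hGZK hmod hCT hLim2 hFW W hcm hr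
      hadd hm1 hirr hab hpar
  · exact missingUpperBoundAt_two_of_katoAtTwoPlusOne_of_even hPlus hGZK hmod hCT W hcm hr hadd hm1 hirr
      (hAnaM2 W hcm hr hadd hj hm1 hirr hab) hpar

end Summit.BirchSwinnertonDyer.BirchSwinnertonDyer.Theorems.AddKatoTwo

end
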